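import Summits.QuantumAdvantage.QuantumAdvantage.Theorems.SosSandwichTransferPBEventMachineInv
import Literature.Computability.Complexity.OracleStateMachine
import Literature.Computability.Complexity.ListFoldBricks
import Literature.Computability.Complexity.FoldBricks
import Literature.Computability.Complexity.PlumbingBricks
import HarnessLib

/-!
# Route `SosSandwich`, crux `TransferPB` (stmt-QuantumAdvantage-15238): the event machine as THREE BRICK PROGRAMS (definitions)

`Defs` file (D-0016 convention; no theorem proved here). Hypothesis (E) of
`Theorems/SosSandwichTransferPBEventMachineOSM.lean` (`stub_pbOracleSimulation_of_eventOSM`) asks, for two polynomials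
`pw, pd`, for a state machine `S : OSM` (`Literature/Computability/Complexity/OracleStateMachine.lean`) whose three
string maps are in `FP`, grow states additively, and CODE the event machine of
`Theorems/SosSandwichTransferPBEventMachineDefs.lean` (`evInit (pd |x|)`, `evDelta (pw |x|)`, `evKappa x`). This file
writes those maps in the brick algebra (`BrickAlgebra.lean`, `ListFoldBricks.lean`, `FoldBricks.lean`,
`PlumbingBricks.lean`) — single transitions, NO loop to clock:

* the state code `encSt s = ⟨tag, ⟨encPathS π, ⟨encList (π.map fst), ⟨1^d, ⟨L, ⟨A, ⟨N, B⟩⟩⟩⟩⟩⟩⟩` (`rec8`; per phase: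
  `L = 1^{lv}` / `1^j`, `A = encList alive` / the picked string, `N = encList next` / `1^{cnt}`, `B =` the option code of
  the running candidate / the output bit) and the phase tags;
* field accessors of the transition's argument `⟨x, ⟨st, [b]⟩⟩` (`dX`, `dSt`, `dF i`, `dB`, `bitT`) and of the action's
  argument `⟨x, st⟩` (`kF i`, `kB`), the argument itself `dArg x st b`; one-bit tests `isC`, `nilT`;
* the pieces of the transition — `finNone`, `finishB`, `memU` (membership of the live string among the revealed ones:
  `Brick.anyFn eqPairFn`), `newB` (the running `List.argmin strNum`: compare `u·1` and `c·1` by value, `Brick.ltFn`),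
  `proceedF`, `delRoot`, `delSingle`, `delBlock0`, `delBlock1`, `delAq`, `delMeans` — and **`del0 pw`** (tag dispatch);
* the cap `capDel G body` (the `rcapF` pattern of `CapBricks.lean` on the state field `nthF 1`): additive growth on EVERY
  input, no effect where the bound holds; **`delF pw G = capDel G (del0 pw)`**;
* **`iniF pd`**, **`kapF`**, and **`evOSM pw pd G : OSM`**.

Sources: S. Arora, B. Barak, Computational Complexity (CUP 2009), §3.4, §1.3; S. Aaronson, A. Ambainis, Theory Comput.
10 (2014), proof of Thm. 23 (p. 14).
-/

-- D-0017: single-conjunct summit ⇒ the duplicate `QuantumAdvantage.QuantumAdvantage` is mandated.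
set_option linter.dupNamespace false

noncomputable section

namespace Summit.QuantumAdvantage.QuantumAdvantage.Cruxes.TransferPB.Birth

open Finset Literature.Computability.Cryptography Literature.Computability.Complexity
  Literature.Computability.QuantumComplexity Literature.Computability.QuantumComplexity.ClassicalSimulation
open Brick Plumb

namespace SimTreePB

namespace EvOSM

/-! ### The state code -/

/-- An eight-field record `⟨a₀, ⟨a₁, … ⟨a₆, a₇⟩…⟩⟩` (last field bare). -/
def rec8 (a₀ a₁ a₂ a₃ a₄ a₅ a₆ a₇ : List Bool) : List Bool :=
  boolPair a₀ (boolPair a₁ (boolPair a₂ (boolPair a₃ (boolPair a₄ (boolPair a₅ (boolPair a₆ a₇))))))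

/-- The record assembled from eight field maps. -/
def mk8 (f₀ f₁ f₂ f₃ f₄ f₅ f₆ f₇ : List Bool → List Bool) : List Bool → List Bool :=
  fanoutFn f₀ (fanoutFn f₁ (fanoutFn f₂ (fanoutFn f₃ (fanoutFn f₄ (fanoutFn f₅ (fanoutFn f₆ f₇))))))

/-- Phase tag: root. -/
def tRoot : List Bool := [false]
/-- Phase tag: single. -/
def tSingle : List Bool := [true]
/-- Phase tag: block0. -/
def tBlock0 : List Bool := [true, false]
/-- Phase tag: block1. -/
def tBlock1 : List Bool := [true, true]
/-- Phase tag: aq. -/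
def tAq : List Bool := [false, false]
/-- Phase tag: means. -/
def tMeans : List Bool := [false, true]
/-- Phase tag: done. -/
def tDone : List Bool := [true, true, true]

/-- The option code of the running candidate: `none ↦ ε`, `some c ↦ 1 c`. -/
def encOpt : Option (List Bool) → List Bool
  | none => []
  | some c => true :: c

/-- **The code of a state** of the event machine (see the module docstring for the field layout). -/
def encSt : EvState → List Bool
  | ⟨π, d, .root⟩ => rec8 tRoot (encPathS π) (encList (π.map Prod.fst)) (ones d) [] [] [] []
  | ⟨π, d, .single lv alive next best⟩ =>
    rec8 tSingle (encPathS π) (encList (π.map Prod.fst)) (ones d) (ones lv) (encList alive) (encList next) (encOpt best)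
  | ⟨π, d, .block0 lv alive next best⟩ =>
    rec8 tBlock0 (encPathS π) (encList (π.map Prod.fst)) (ones d) (ones lv) (encList alive) (encList next) (encOpt best)
  | ⟨π, d, .block1 lv alive next best⟩ =>
    rec8 tBlock1 (encPathS π) (encList (π.map Prod.fst)) (ones d) (ones lv) (encList alive) (encList next) (encOpt best)
  | ⟨π, d, .aq u⟩ => rec8 tAq (encPathS π) (encList (π.map Prod.fst)) (ones d) [] u [] []
  | ⟨π, d, .means j cnt⟩ => rec8 tMeans (encPathS π) (encList (π.map Prod.fst)) (ones d) (ones j) [] (ones cnt) []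
  | ⟨π, d, .done b⟩ => rec8 tDone (encPathS π) (encList (π.map Prod.fst)) (ones d) [] [] [] [b]

/-! ### Accessors and tests -/

/-- The transition's argument `⟨x, ⟨st, [b]⟩⟩` (input, state code, answer bit). -/
def dArg (x st : List Bool) (b : Bool) : List Bool := boolPair x (boolPair st [b])

/-- The input `x` of the transition's argument `⟨x, ⟨st, [b]⟩⟩`. -/
def dX : List Bool → List Bool := fstF
/-- The state `st` of the transition's argument. -/
def dSt : List Bool → List Bool := nthF 1
/-- The answer block `[b]` of the transition's argument. -/
def dBit : List Bool → List Bool := sndPow 1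
/-- Field `i ≤ 6` of the state, read off the transition's argument. -/
def dF (i : ℕ) : List Bool → List Bool := nthF i ∘ nthF 1
/-- The last field (`B`) of the state, read off the transition's argument. -/
def dB : List Bool → List Bool := sndPow 6 ∘ nthF 1
/-- Field `i ≤ 6` of the state, read off the action's argument `⟨x, st⟩`. -/
def kF (i : ℕ) : List Bool → List Bool := nthF (i + 1)
/-- The last field of the state, read off the action's argument. -/
def kB : List Bool → List Bool := sndPow 7

/-- One-bit test `[f z = c]`. -/
def isC (f : List Bool → List Bool) (c : List Bool) : List Bool → List Bool := eqPairFn ∘ fanoutFn f fun _ => c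
/-- One-bit test `[f z = ε]`. -/
def nilT (f : List Bool → List Bool) : List Bool → List Bool := isNilFn ∘ f
/-- The answer bit as a one-bit test `[answer block = [1]]`. -/
def bitT : List Bool → List Bool := isC dBit [true]

/-! ### Pieces of the transition (all maps of the transition's argument) -/

/-- The live string at hand: the head of the `A` field. -/
def hdA : List Bool → List Bool := fstF ∘ dF 5
/-- The code of the rest of the current level: the tail of the `A` field. -/
def tlA : List Bool → List Bool := sndF ∘ dF 5
/-- `1^W` for the width bound `W = pw(|x|)`. -/
def wOnes (pw : Polynomial ℕ) : List Bool → List Bool := polyFn pw ∘ dX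

/-- The code of `finish π d none = ⟨π, 0, means 1 0⟩`. -/
def finNone : List Bool → List Bool :=
  mk8 (fun _ => tMeans) (dF 1) (dF 2) (fun _ => []) (fun _ => ones 1) (fun _ => []) (fun _ => []) (fun _ => [])

/-- The code of `finish π d best` for the option code `Bf`. -/
def finishB (Bf : List Bool → List Bool) : List Bool → List Bool :=
  iteFn (nilT Bf) finNone
    (mk8 (fun _ => tAq) (dF 1) (dF 2) (dF 3) (fun _ => []) (List.tail ∘ Bf) (fun _ => []) (fun _ => []))

/-- `[u ∈ revealed strings]` for the live string `u` at hand. -/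
def memU : List Bool → List Bool := anyFn eqPairFn ∘ fanoutFn hdA (dF 2)

/-- `f z · 1` (the canonical numeral behind `strNum`). -/
def app1 (f : List Bool → List Bool) : List Bool → List Bool := fun z => f z ++ [true]

/-- The new option code of the running candidate after the SINGLE answer (`bump`/`better`). -/
def newB : List Bool → List Bool :=
  iteFn (andFn bitT (notFn memU))
    (iteFn (nilT dB) (List.cons true ∘ hdA)
      (iteFn (ltFn ∘ fanoutFn (app1 hdA) (app1 (List.tail ∘ dB))) (List.cons true ∘ hdA) dB))
    dB

/-- The code of `proceed π d lv rest next best` from the codes `Lf = 1^{lv}`, `Rf = encList rest`, `Nf = encList next`,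
`Bf = encOpt best`. -/
def proceedF (Lf Rf Nf Bf : List Bool → List Bool) : List Bool → List Bool :=
  iteFn (nilT Rf)
    (iteFn (nilT Lf) (finishB Bf)
      (iteFn (nilT Nf) (finishB Bf)
        (mk8 (fun _ => tSingle) (dF 1) (dF 2) (dF 3) (List.tail ∘ Lf) Nf (fun _ => []) Bf)))
    (mk8 (fun _ => tSingle) (dF 1) (dF 2) (dF 3) Lf Rf Nf Bf)

/-- Transition at `root`. -/
def delRoot (pw : Polynomial ℕ) : List Bool → List Bool :=
  iteFn (nilT (wOnes pw)) finNone
    (iteFn bitT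
      (mk8 (fun _ => tSingle) (dF 1) (dF 2) (dF 3) (List.tail ∘ wOnes pw) (fun _ => boolPair [] []) (fun _ => [])
        (fun _ => []))
      finNone)

/-- Transition at `single`. -/
def delSingle : List Bool → List Bool :=
  iteFn (nilT (dF 5)) dSt
    (iteFn (nilT (dF 4)) (proceedF (dF 4) tlA (dF 6) newB)
      (mk8 (fun _ => tBlock0) (dF 1) (dF 2) (dF 3) (dF 4) (dF 5) (dF 6) newB))

/-- The `N` field with the item `a z` appended: `encList next ++ ⟨a, ε⟩ = encList (next ++ [a])`. -/
def appendItem (Nf a : List Bool → List Bool) : List Bool → List Bool := fun z => Nf z ++ boolPair (a z) []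

/-- The `N` field after the BLOCK answer for the child `u·b₀`. -/
def nChild (b₀ : Bool) : List Bool → List Bool :=
  iteFn bitT (appendItem (dF 6) fun z => hdA z ++ [b₀]) (dF 6)

/-- Transition at `block0`. -/
def delBlock0 : List Bool → List Bool :=
  iteFn (nilT (dF 5)) dSt (mk8 (fun _ => tBlock1) (dF 1) (dF 2) (dF 3) (dF 4) (dF 5) (nChild false) dB)

/-- Transition at `block1`. -/
def delBlock1 : List Bool → List Bool :=
  iteFn (nilT (dF 5)) dSt (proceedF (dF 4) tlA (nChild true) dB)

/-- The new serialised path after the `A`-answer: `encPathS π ++ ⟨b u, ε⟩ = encPathS (π ++ [(u, b)])`. -/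
def newP : List Bool → List Bool := fun z => dF 1 z ++ boolPair (dBit z ++ dF 5 z) []

/-- The new code of the revealed strings after the `A`-answer. -/
def newU : List Bool → List Bool := appendItem (dF 2) (dF 5)

/-- Transition at `aq`. -/
def delAq : List Bool → List Bool :=
  iteFn (nilT (List.tail ∘ dF 3))
    (mk8 (fun _ => tMeans) newP newU (fun _ => []) (fun _ => ones 1) (fun _ => []) (fun _ => []) (fun _ => []))
    (mk8 (fun _ => tRoot) newP newU (List.tail ∘ dF 3) (fun _ => []) (fun _ => []) (fun _ => []) (fun _ => []))

/-- The MEAN count after the answer. -/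
def newC : List Bool → List Bool := iteFn bitT (List.cons true ∘ dF 6) (dF 6)

/-- Transition at `means`. -/
def delMeans : List Bool → List Bool :=
  iteFn (ltLenF ∘ fanoutFn (fun _ => ones 39) (dF 4))
    (mk8 (fun _ => tDone) (dF 1) (dF 2) (dF 3) (fun _ => []) (fun _ => []) (fun _ => [])
      (ltLenF ∘ fanoutFn (fun _ => ones 19) newC))
    (mk8 (fun _ => tMeans) (dF 1) (dF 2) (dF 3) (List.cons true ∘ dF 4) (fun _ => []) newC (fun _ => []))

/-- **The uncapped transition**: dispatch on the phase tag. -/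
def del0 (pw : Polynomial ℕ) : List Bool → List Bool :=
  iteFn (isC (dF 0) tRoot) (delRoot pw)
    (iteFn (isC (dF 0) tSingle) delSingle
      (iteFn (isC (dF 0) tBlock0) delBlock0
        (iteFn (isC (dF 0) tBlock1) delBlock1
          (iteFn (isC (dF 0) tAq) delAq
            (iteFn (isC (dF 0) tMeans) delMeans dSt)))))

/-! ### The cap, the transition, the initial state, the action -/

/-- The length test of the cap: `[|body z| < |st| + G(|x|) + 1]` on `z = ⟨x, ⟨st, _⟩⟩`. -/
def capTest (G : Polynomial ℕ) (body : List Bool → List Bool) : List Bool → List Bool :=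
  ltLenF ∘ fanoutFn body (appF ∘ fanoutFn dSt (polyFn (G + 1) ∘ dX))

/-- **The capped body**: `body z` if it is at most `G(|x|)` longer than the state `st`, else `st`. -/
def capDel (G : Polynomial ℕ) (body : List Bool → List Bool) : List Bool → List Bool :=
  iteFn (capTest G body) body dSt

/-- **The transition** of the `OSM`. -/
def delF (pw G : Polynomial ℕ) : List Bool → List Bool := capDel G (del0 pw)

/-- **The initial state** on input `x`: `evInit (pd |x|)`. -/
def iniF (pd : Polynomial ℕ) : List Bool → List Bool :=
  iteFn (nilT (polyFn pd))
    (mk8 (fun _ => tMeans) (fun _ => []) (fun _ => []) (fun _ => []) (fun _ => ones 1) (fun _ => []) (fun _ => [])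
      (fun _ => []))
    (mk8 (fun _ => tRoot) (fun _ => []) (fun _ => []) (polyFn pd) (fun _ => []) (fun _ => []) (fun _ => [])
      (fun _ => []))

/-- The instance code `0 1 ⟨x, ⟨P, v⟩⟩` of a query `true :: boolPair x (boolPair (encPathS π) v)` to the answer function. -/
def qryG (v : List Bool → List Bool) : List Bool → List Bool :=
  List.cons false ∘ List.cons true ∘ fanoutFn fstF (fanoutFn (kF 1) v)

/-- **The action** of the `OSM` on `⟨x, st⟩`: `0 q` for the pending query `q`, `1 b` for the output `b`. -/
def kapF : List Bool → List Bool :=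
  iteFn (isC (kF 0) tRoot) (qryG fun _ => [false, false])
    (iteFn (isC (kF 0) tSingle)
      (iteFn (nilT (kF 5)) (fun _ => [true, false]) (qryG (List.cons false ∘ List.cons true ∘ fstF ∘ kF 5)))
      (iteFn (isC (kF 0) tBlock0)
        (iteFn (nilT (kF 5)) (fun _ => [true, false])
          (qryG (List.cons false ∘ List.cons false ∘ fun z => fstF (kF 5 z) ++ [false])))
        (iteFn (isC (kF 0) tBlock1)
          (iteFn (nilT (kF 5)) (fun _ => [true, false])
            (qryG (List.cons false ∘ List.cons false ∘ fun z => fstF (kF 5 z) ++ [true])))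
          (iteFn (isC (kF 0) tAq) (List.cons false ∘ List.cons false ∘ kF 5)
            (iteFn (isC (kF 0) tMeans) (qryG (List.cons true ∘ kF 4))
              (iteFn (isC (kF 0) tDone) (List.cons true ∘ kB) (fun _ => [true, false])))))))

/-- **The state machine** implementing the event machine with width bound `pw(|x|)`, round budget `pd(|x|)` and cap
polynomial `G`. -/
def evOSM (pw pd G : Polynomial ℕ) : OSM where
  ini := iniF pd
  del := delF pw G
  kap := kapF


end EvOSM

end SimTreePB

end Summit.QuantumAdvantage.QuantumAdvantage.Cruxes.TransferPB.Birth

end
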